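import Literature.IUT.HodgeArakelov.BadPlaceSettingOfDoubleUnderline
import Literature.AnabelianGeometry.EtaleTheta.Discharge.Sec2Prop24ModelCharacteristic

/-!
# (H1) `PiYddCharacteristic` of the [EtTh] model from [EtTh] Prop. 2.4 (i) at the model (proof-only)

abc-iut cell, seat abc-iut-L6-d6 (gen 3), row W3-L2-02 / P1-b (abc-iut-L2-lead). The L6-side restatement of
`Literature/AnabelianGeometry/EtaleTheta/Discharge/Sec2Prop24ModelCharacteristic.lean`: abc-iut-L6-t1's named
hypothesis (H1) `EtaleThetaDataOfSetting.PiYddCharacteristic C` of the [IUTchII] Prop. 1.4 bridge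
(`EtaleThetaDataOfSetting.lean`, "every topological automorphism of `Π^tp_{X̲̲}` stabilises `Π^tp_{Ÿ̲̲}`"
[claim: Mochizuki2012, status: disputed] (IUTchII §1 Prop 1.4, kurims p.27)) HOLDS modulo the printed
[EtTh] Prop. 2.4 (i) input at the model — binder `hP24` (GAP-LEDGER G-L6d6-2: every topological automorphism of
`Π^tp_{X̲̲}` extends to one of `Π^tp_X` stabilising `Π^tp_Ÿ`; [cite: MochizukiEtTh2009, Prop 2.4 p.38]) — instead of
the whole named fact [EtTh] Cor. 2.18 (i) (abc-iut-w4-d013's `piYddCharacteristic_of_cor218_i`); and the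
[IUTchII] Prop. 2.1 well-definedness at the model bad-place setting (abc-iut-w4-d034 / abc-iut-w4-d010's
`TemperedCoverings.YL_eq_of_piYddCharacteristic`) under the same binder. The `Y̲̲`-clause ALONE follows from the
weaker binder of G-L6d6-1 (`…_of_compactlyGenerated`). Proof-only: no definition, no new named fact; nothing
disputed is asserted; no side is taken on [IUTchIII] Cor. 3.12; typed ≠ discharged.
-/

noncomputable section

namespace Literature.IUT.HodgeArakelov

open Literature.AnabelianGeometry.EtaleTheta

namespace EtaleThetaDataOfSetting

variable {p : ℕ} [Fact p.Prime] {D : Literature.AnabelianGeometry.EtaleTheta.ThetaSetting p}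
  {E : D.EtaleThetaData} {l : ℕ} (C : E.DoubleUnderline l)

/-- **(H1) from [EtTh] Prop. 2.4 (i) at the model**: if every topological automorphism of `Π^tp_{X̲̲}` extends
to one of `Π^tp_X` stabilising `Π^tp_Ÿ` (binder `hP24`, G-L6d6-2), then every topological automorphism of
`Π^tp_{X̲̲}` stabilises `Π^tp_{Ÿ̲̲}` — abc-iut-L6-t1's `PiYddCharacteristic C`.
[claim: Mochizuki2012, status: disputed] (IUTchII §1 Prop 1.4, kurims p.27) -/
theorem piYddCharacteristic_of_prop24
    (hP24 : ∀ γ : C.Huu ≃ₜ* C.Huu, ∃ Γ : D.PiTemp ≃ₜ* D.PiTemp,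
      (∀ h : C.Huu, (Γ h : D.PiTemp) = γ h) ∧ D.GtpYdd.map Γ.toMulEquiv.toMonoidHom = D.GtpYdd) :
    PiYddCharacteristic C :=
  fun α => C.map_GtpYdduu_subgroupOf_eq_of_prop24 hP24 α

/-- The same with the `Ÿ`-stabilisation read on `Π^tp_{Y₂}` (`Π^tp_Ÿ = Π^tp_{Y₂}`, abc-iut-L6-d5's
`Thm16Sub.GtpYdd_eq_GtpYN_two`). [claim: Mochizuki2012, status: disputed] (IUTchII §1 Prop 1.4, kurims p.27) -/
theorem piYddCharacteristic_of_prop24_YN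
    (hP24 : ∀ γ : C.Huu ≃ₜ* C.Huu, ∃ Γ : D.PiTemp ≃ₜ* D.PiTemp,
      (∀ h : C.Huu, (Γ h : D.PiTemp) = γ h) ∧ (D.GtpYN 2).map Γ.toMulEquiv.toMonoidHom = D.GtpYN 2) :
    PiYddCharacteristic C :=
  fun α => C.map_GtpYdduu_subgroupOf_eq_of_prop24_YN hP24 α

/-- **The `Y̲̲`-companion needs no extension**: granted only that `Π^tp_{Y̲̲}` is topologically generated by the
compact subgroups of `Π^tp_{X̲̲}` (binder `hYuu`, G-L6d6-1 — the `X̲̲`-reading of the printed DEFINITION of `Z`),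
every topological automorphism of `Π := Π^tp_{X̲̲}` stabilises `Π^tp_{Y̲̲} = Π^tp_Y ∩ Π^tp_{X̲̲}`.
[claim: Mochizuki2012, status: disputed] (IUTchII §1 Prop 1.4, kurims p.27) -/
theorem map_GtpY_subgroupOf_eq_of_compactlyGenerated
    (hYuu : D.GtpY.subgroupOf C.Huu ≤
      (Subgroup.closure {h : C.Huu | ∃ K : Subgroup C.Huu, IsCompact (K : Set C.Huu) ∧ h ∈ K}).topologicalClosure)
    (α : (Pi C) ≃ₜ* (Pi C)) :
    (D.GtpY.subgroupOf C.Huu).map α.toMulEquiv.toMonoidHom = D.GtpY.subgroupOf C.Huu :=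
  C.map_GtpY_subgroupOf_Huu_eq_of_compactlyGenerated hYuu α

end EtaleThetaDataOfSetting

namespace BadPlaceSetting

variable {p : ℕ} [Fact p.Prime] {D : Literature.AnabelianGeometry.EtaleTheta.ThetaSetting p}
  {E : D.EtaleThetaData} {l : ℕ} (C : E.DoubleUnderline l) {N : ℕ+} (μ : D.CyclotomeMod l N)
  (hC : D.Compat) (hS : D.Sec2Hyps)
  (hl : l.Prime) (hp2 : p ≠ 2) (hpl : p ≠ l) (hζ : ∃ ζ : D.K, IsPrimitiveRoot ζ (4 * l))
  {η : (C.thetaEnvData μ hC hS).PiYdd → MuN p N} (hη : η ∈ (C.thetaEnvData μ hC hS).thetaCocycles)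

/-- **[IUTchII] Prop. 2.1 well-definedness at the model bad-place setting, from [EtTh] Prop. 2.4 (i) at the
model** (binder `hP24`, G-L6d6-2; composition with `TemperedCoverings.YL_eq_of_piYddCharacteristic`): any two
Prop. 2.1 outputs over the same topological group `P` have the same top row `Π^tp_{Ÿ̲_v} ⊆ Π^tp_{Y̲_v} ⊆ P`.
[claim: Mochizuki2012, status: disputed] (IUTchII §2 Prop 2.1, kurims p.65) -/
theorem _root_.Literature.IUT.HodgeArakelov.TemperedCoverings.YL_eq_of_prop24Model
    (hP24 : ∀ γ : C.Huu ≃ₜ* C.Huu, ∃ Γ : D.PiTemp ≃ₜ* D.PiTemp,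
      (∀ h : C.Huu, (Γ h : D.PiTemp) = γ h) ∧ D.GtpYdd.map Γ.toMulEquiv.toMonoidHom = D.GtpYdd)
    {P : TopGroup.{0}} (T₁ T₂ : TemperedCoverings (ofDoubleUnderline C μ hC hS hl hp2 hpl hζ hη) P) :
    T₁.YL = T₂.YL ∧ T₁.YddL = T₂.YddL :=
  TemperedCoverings.YL_eq_of_piYddCharacteristic C μ hC hS hl hp2 hpl hζ hη
    (EtaleThetaDataOfSetting.piYddCharacteristic_of_prop24 C hP24) T₁ T₂

end BadPlaceSetting

end Literature.IUT.HodgeArakelov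

end
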